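import Mathlib
import HarnessLib
import Summits.Ventures.LatticeQCDFlow.Scaling.SU3HaarSmallBall
import Literature.Barriers.QuantumFields.CenterSymmetryBreakingByQuarks
import Summits.Ventures.LatticeQCDFlow.Scaling.AutoregressiveGaugeKLExtensiveAllPlanes

/-!
# LatticeQCDFlow / Scaling — THE VOLUME LAW WITH EXPLICIT CONSTANTS FOR `SU(3)`, ALL ORIENTATIONS: in every
# generation order, an endpoint-blind autoregressive model of `SU(3)` lattice gauge theory (`d ≥ 2`,
# `K = (d−1)β ≥ 2`, `17 + 3 log K ≤ K`) has training loss `≥ (d·L^d/4)·(1 − (17 + 3 log K)/K)²/2` and drives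
# an exact sampler with `τ_int(sign) ≥ exp((d·L^d/4)·(1 − (17 + 3 log K)/K)²/2) − ½`

HONEST FRAMING: exact (Metropolis-corrected) sampling algorithms for lattice gauge theory;
figures of merit are autocorrelation/cost numbers at stated couplings and volumes; no
continuum-physics claim.

Venture `LatticeQCDFlow` (cell pub-lqcd), topic `Scaling`, FANOUT row 30 (lean-1, GEN-21) — OUR WORK on
THEORY-2.md §4 row C5: the `SU(3)` instance — the lattice-QCD gauge group — of
`Scaling/AutoregressiveGaugeKLExtensiveAllPlanes` (the volume law with any common plaquette-mean floor `w`)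
with OUR explicit volume-uniform weak-coupling plaquette floor for `SU(3)`
(`Scaling/SU3HaarSmallBall.wilsonExpectation_plaquette_ge_su3`: `⟨(1/3)Re tr U_p⟩_{Λ_L,β} ≥ 1 − (17 + 3 log K)/K`,
`K = (d−1)β ≥ 2`, from the `SU(3)` small-ball bound `Haar{‖U − 1‖_F ≤ r} ≥ r⁸/(64000π⁸)` proved there by
Weyl's integral formula) as `w`, and the centre `e^{2πi/3}·1 ∈ SU(3)`
(`Literature/Barriers/…/CenterSymmetryBreakingByQuarks.scalarCenter`).

## What is proved (all [ours])

* **`su3_kl_arHybrid_ge_dim_mul_card_site`** — `d ≥ 2`, `L ≥ 2`, `K = (d−1)β ≥ 2` with `17 + 3 log K ≤ K`;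
  ANY duplicate-free list of ALL links; squeezed conditionals normalised in their link and not reading
  later links, each `q_e` blind to the other links at an endpoint `Y e` of `e`:
  `(d·L^d/4)·(1 − (17 + 3 log K)/K)²/2 ≤ KL(e^{−βS_W}/Z ‖ H_l)`.
* **`su3_tauInt_sign_ge_exp_dim_mul_card_site`** — for every measurable balanced sign observable `g` of the
  exact independence sampler: `exp((d·L^d/4)·(1 − (17 + 3 log K)/K)²/2) − ½ ≤ τ_int(g)`.

READING (value-free): tree units — `β` multiplies `Σ_p (3 − Re tr U_p)`, so `β = β_W/3` for Wilson's
`β_W Σ_p (1 − (1/3)Re tr U_p)`; in `d = 4`, `K = 3β = β_W` and `17 + 3 log K ≤ K` holds from `K ≥ 32`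
(`17 + 3 log 32 = 27.4`): for four-dimensional `SU(3)` lattice gauge theory at every `β_W ≥ 32` and every
volume `L^4`, an exact sampler driven by an endpoint-blind autoregressive model has
`τ_int(sign) ≥ exp(L^4·(1 − (17 + 3 log β_W)/β_W)²/2) − ½` and Kish fraction `≤ exp(−L^4·(…)²/2)`, the
rate per site tending to `½` as `β_W → ∞`.  The threshold reflects the unoptimised small-ball constant and
the Jensen mechanism (`log β/β`), not physics; at smaller `β` the law holds with the (volume-wise positive)
plaquette mean (`…AllPlanes`) and at strong coupling with a volume-free rate (`…StrongCoupling`).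
NOT CLAIMED: anything for `K < 2` or `17 + 3 log K > K` beyond those two files; the acceptance itself.
No `def`, no `sorry`, nothing cited as a fact beyond the tree.
-/

noncomputable section
noncomputable section

namespace Summit.Ventures.LatticeQCDFlow.Theory2.Autoregressive

open MeasureTheory Function Set
open Literature.MathematicalPhysics.QuantumFieldTheory Literature.MathematicalPhysics.QuantumLattice
open Summit.Ventures.LatticeQCDFlow.Exactness Summit.Ventures.LatticeQCDFlow.Scoring
open scoped Matrix Matrix.Norms.Frobenius

variable {d L : ℕ} [NeZero L]

set_option maxHeartbeats 400000 in
/-- **THE `SU(3)` VOLUME LAW FOR THE TRAINING LOSS, explicit constants, all orientations.**  `d ≥ 2`,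
`L ≥ 2`, `K = (d−1)β ≥ 2` with `17 + 3 log K ≤ K`; `l` any duplicate-free list of ALL links; squeezed
conditionals normalised in their link and not reading later links; every `q_e` blind to the other links at
an endpoint `Y e` of `e`.  Then `(d·L^d/4)·(1 − (17 + 3 log K)/K)²/2 ≤ KL(e^{−βS_W}/Z ‖ H_l)`. [ours] -/
theorem su3_kl_arHybrid_ge_dim_mul_card_site (hd : 2 ≤ d) (hL : 2 ≤ L) {β : ℝ}
    (hK : 2 ≤ ((d : ℝ) - 1) * β)
    (hK' : 17 + 3 * Real.log (((d : ℝ) - 1) * β) ≤ ((d : ℝ) - 1) * β)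
    {q : Edge d L → GaugeConfig d L (Matrix.specialUnitaryGroup (Fin 3) ℂ) → ℝ}
    (hqm : ∀ a, Measurable (q a)) {cq Cq : ℝ} (hcq : 0 < cq)
    (hqlo : ∀ a U, cq ≤ q a U) (hqhi : ∀ a U, q a U ≤ Cq)
    (hq1 : ∀ a U, ∫ v, q a (update U a v) ∂(haarProbability (Matrix.specialUnitaryGroup (Fin 3) ℂ)) = 1)
    (l : List (Edge d L)) (hl : l.Nodup) (hall : ∀ e : Edge d L, e ∈ l)
    (hpw : l.Pairwise (fun a b => ∀ (U : GaugeConfig d L (Matrix.specialUnitaryGroup (Fin 3) ℂ))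
      (v : Matrix.specialUnitaryGroup (Fin 3) ℂ), q a (update U b v) = q a U))
    (Y : Edge d L → Site d L) (hY : ∀ e : Edge d L, e.1 = Y e ∨ e.1.shift e.2 = Y e)
    (hqB : ∀ e e' : Edge d L, e'.1 = Y e ∨ e'.1.shift e'.2 = Y e → e' ≠ e →
      ∀ (U : GaugeConfig d L (Matrix.specialUnitaryGroup (Fin 3) ℂ)) (v : Matrix.specialUnitaryGroup (Fin 3) ℂ),
        q e (update U e' v) = q e U) :
    (d : ℝ) * (L : ℝ) ^ d / 4 * (1 - (17 + 3 * Real.log (((d : ℝ) - 1) * β)) / (((d : ℝ) - 1) * β)) ^ 2 / 2 ≤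
      ∫ U, Real.exp (-β * wilsonAction (fundamentalRep (Fin 3)) U) /
            (∫ W, Real.exp (-β * wilsonAction (fundamentalRep (Fin 3)) W)
              ∂Measure.pi (fun _ : Edge d L => haarProbability (Matrix.specialUnitaryGroup (Fin 3) ℂ))) *
          Real.log ((Real.exp (-β * wilsonAction (fundamentalRep (Fin 3)) U) /
              ∫ W, Real.exp (-β * wilsonAction (fundamentalRep (Fin 3)) W)
                ∂Measure.pi (fun _ : Edge d L => haarProbability (Matrix.specialUnitaryGroup (Fin 3) ℂ))) /
            ((l.map fun b => q b U).prod *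
                coordAvg (haarProbability (Matrix.specialUnitaryGroup (Fin 3) ℂ)) l.toFinset
                  (fun V : GaugeConfig d L (Matrix.specialUnitaryGroup (Fin 3) ℂ) =>
                    Real.exp (-β * wilsonAction (fundamentalRep (Fin 3)) V)) U /
              ∫ W, Real.exp (-β * wilsonAction (fundamentalRep (Fin 3)) W)
                ∂Measure.pi (fun _ : Edge d L => haarProbability (Matrix.specialUnitaryGroup (Fin 3) ℂ))))
        ∂Measure.pi (fun _ : Edge d L => haarProbability (Matrix.specialUnitaryGroup (Fin 3) ℂ)) := by
  haveI : SecondCountableTopology (Matrix (Fin 3) (Fin 3) ℂ) :=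
    inferInstanceAs (SecondCountableTopology (Fin 3 → Fin 3 → ℂ))
  haveI : SecondCountableTopology (Matrix.specialUnitaryGroup (Fin 3) ℂ) :=
    Topology.IsEmbedding.subtypeVal.secondCountableTopology
  have hd1 : (0 : ℝ) < (d : ℝ) - 1 := by
    have : (2 : ℝ) ≤ d := by exact_mod_cast hd
    linarith
  have hβ : 0 < β := by
    by_contra h
    have : ((d : ℝ) - 1) * β ≤ 0 := mul_nonpos_of_nonneg_of_nonpos hd1.le (not_lt.1 h)
    linarith
  have hKpos : 0 < ((d : ℝ) - 1) * β := by linarith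
  -- the central element `ω·1 ∈ SU(3)`, `ω = e^{2πi/3} ≠ 1`, `‖ω‖ = 1`
  have hprim : IsPrimitiveRoot (Complex.exp (2 * Real.pi * Complex.I / (3 : ℕ))) 3 :=
    Complex.isPrimitiveRoot_exp 3 (by norm_num)
  have hωn : Complex.exp (2 * Real.pi * Complex.I / (3 : ℕ)) ^ 3 = 1 := hprim.pow_eq_one
  have hne : Complex.exp (2 * Real.pi * Complex.I / (3 : ℕ)) ≠ 1 := hprim.ne_one (by norm_num)
  have hω : fundamentalRep (Fin 3)
      (Literature.Barriers.QuantumFields.scalarCenter 3 _ hωn (by norm_num)) =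
      Complex.exp (2 * Real.pi * Complex.I / (3 : ℕ)) • (1 : Matrix (Fin 3) (Fin 3) ℂ) := rfl
  -- the explicit floor is a common lower bound of all plaquette means, and is non-negative
  have hw0 : 0 ≤ 1 - (17 + 3 * Real.log (((d : ℝ) - 1) * β)) / (((d : ℝ) - 1) * β) := by
    rw [sub_nonneg, div_le_one hKpos]
    exact hK'
  have hw : ∀ p : Plaquette d L, 1 - (17 + 3 * Real.log (((d : ℝ) - 1) * β)) / (((d : ℝ) - 1) * β) ≤
      wilsonExpectation (fundamentalRep (Fin 3)) β
        (fun U : GaugeConfig d L (Matrix.specialUnitaryGroup (Fin 3) ℂ) =>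
          ((3 : ℕ) : ℝ)⁻¹ * (fundamentalRep (Fin 3) (plaquetteHolonomy U p.1 p.2.1.1 p.2.1.2)).trace.re) :=
    fun p => Theory2.WeakCoupling.wilsonExpectation_plaquette_ge_su3 hd hK p.1 (ne_of_lt p.2.2)
  have hmain := wilson_kl_arHybrid_ge_dim_mul_card_site_div_four_mul_sq (d := d) (L := L) (fundamentalRep (Fin 3))
    hd (continuous_fundamentalRep (Fin 3)) hL hω hne hw0 hw hqm hcq hqlo hqhi hq1 l hl hall hpw Y hY hqB
  have hcardSite : Fintype.card (Site d L) = L ^ d := by simp [Site, ZMod.card]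
  rw [hcardSite] at hmain
  push_cast at hmain
  exact hmain

set_option maxHeartbeats 400000 in
/-- **THE `SU(3)` EXPONENTIAL SLOWING DOWN, explicit constants, all orientations.**  Under the hypotheses of
`su3_kl_arHybrid_ge_dim_mul_card_site`, for every measurable balanced sign observable `g` (`g² = 1`,
`∫ g e^{−βS_W} dπ = 0`) of the exact independence sampler with target `e^{−βS_W}/Z` and the autoregressive
proposal: `exp((d·L^d/4)·(1 − (17 + 3 log K)/K)²/2) − ½ ≤ τ_int(g)`. [ours] -/
theorem su3_tauInt_sign_ge_exp_dim_mul_card_site (hd : 2 ≤ d) (hL : 2 ≤ L) {β : ℝ}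
    (hK : 2 ≤ ((d : ℝ) - 1) * β)
    (hK' : 17 + 3 * Real.log (((d : ℝ) - 1) * β) ≤ ((d : ℝ) - 1) * β)
    {q : Edge d L → GaugeConfig d L (Matrix.specialUnitaryGroup (Fin 3) ℂ) → ℝ}
    (hqm : ∀ a, Measurable (q a)) {cq Cq : ℝ} (hcq : 0 < cq)
    (hqlo : ∀ a U, cq ≤ q a U) (hqhi : ∀ a U, q a U ≤ Cq)
    (hq1 : ∀ a U, ∫ v, q a (update U a v) ∂(haarProbability (Matrix.specialUnitaryGroup (Fin 3) ℂ)) = 1)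
    (l : List (Edge d L)) (hl : l.Nodup) (hall : ∀ e : Edge d L, e ∈ l)
    (hpw : l.Pairwise (fun a b => ∀ (U : GaugeConfig d L (Matrix.specialUnitaryGroup (Fin 3) ℂ))
      (v : Matrix.specialUnitaryGroup (Fin 3) ℂ), q a (update U b v) = q a U))
    (Y : Edge d L → Site d L) (hY : ∀ e : Edge d L, e.1 = Y e ∨ e.1.shift e.2 = Y e)
    (hqB : ∀ e e' : Edge d L, e'.1 = Y e ∨ e'.1.shift e'.2 = Y e → e' ≠ e →
      ∀ (U : GaugeConfig d L (Matrix.specialUnitaryGroup (Fin 3) ℂ)) (v : Matrix.specialUnitaryGroup (Fin 3) ℂ),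
        q e (update U e' v) = q e U)
    {g : GaugeConfig d L (Matrix.specialUnitaryGroup (Fin 3) ℂ) → ℝ} (hgm : Measurable g)
    (hg1 : ∀ U, g U ^ 2 = 1)
    (hg0 : ∫ U, g U * Real.exp (-β * wilsonAction (fundamentalRep (Fin 3)) U)
      ∂Measure.pi (fun _ : Edge d L => haarProbability (Matrix.specialUnitaryGroup (Fin 3) ℂ)) = 0) :
    Real.exp ((d : ℝ) * (L : ℝ) ^ d / 4 *
        (1 - (17 + 3 * Real.log (((d : ℝ) - 1) * β)) / (((d : ℝ) - 1) * β)) ^ 2 / 2) - 1 / 2 ≤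
      tauInt (fun k => (∫ U, g U *
          ((imhOp (Measure.pi fun _ : Edge d L => haarProbability (Matrix.specialUnitaryGroup (Fin 3) ℂ))
            (fun V : GaugeConfig d L (Matrix.specialUnitaryGroup (Fin 3) ℂ) =>
              Real.exp (-β * wilsonAction (fundamentalRep (Fin 3)) V))
            (fun V : GaugeConfig d L (Matrix.specialUnitaryGroup (Fin 3) ℂ) => (l.map fun b => q b V).prod *
                coordAvg (haarProbability (Matrix.specialUnitaryGroup (Fin 3) ℂ)) l.toFinset
                  (fun V' : GaugeConfig d L (Matrix.specialUnitaryGroup (Fin 3) ℂ) =>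
                    Real.exp (-β * wilsonAction (fundamentalRep (Fin 3)) V')) V /
              ∫ W, Real.exp (-β * wilsonAction (fundamentalRep (Fin 3)) W)
                ∂Measure.pi (fun _ : Edge d L => haarProbability (Matrix.specialUnitaryGroup (Fin 3) ℂ))))^[k]
            g) U * Real.exp (-β * wilsonAction (fundamentalRep (Fin 3)) U)
          ∂Measure.pi (fun _ : Edge d L => haarProbability (Matrix.specialUnitaryGroup (Fin 3) ℂ))) /
          ∫ U, g U ^ 2 * Real.exp (-β * wilsonAction (fundamentalRep (Fin 3)) U)
            ∂Measure.pi (fun _ : Edge d L => haarProbability (Matrix.specialUnitaryGroup (Fin 3) ℂ))) := by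
  haveI : SecondCountableTopology (Matrix (Fin 3) (Fin 3) ℂ) :=
    inferInstanceAs (SecondCountableTopology (Fin 3 → Fin 3 → ℂ))
  haveI : SecondCountableTopology (Matrix.specialUnitaryGroup (Fin 3) ℂ) :=
    Topology.IsEmbedding.subtypeVal.secondCountableTopology
  have hd1 : (0 : ℝ) < (d : ℝ) - 1 := by
    have : (2 : ℝ) ≤ d := by exact_mod_cast hd
    linarith
  have hβ : 0 < β := by
    by_contra h
    have : ((d : ℝ) - 1) * β ≤ 0 := mul_nonpos_of_nonneg_of_nonpos hd1.le (not_lt.1 h)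
    linarith
  have hKpos : 0 < ((d : ℝ) - 1) * β := by linarith
  -- the central element `ω·1 ∈ SU(3)`, `ω = e^{2πi/3} ≠ 1`, `‖ω‖ = 1`
  have hprim : IsPrimitiveRoot (Complex.exp (2 * Real.pi * Complex.I / (3 : ℕ))) 3 :=
    Complex.isPrimitiveRoot_exp 3 (by norm_num)
  have hωn : Complex.exp (2 * Real.pi * Complex.I / (3 : ℕ)) ^ 3 = 1 := hprim.pow_eq_one
  have hne : Complex.exp (2 * Real.pi * Complex.I / (3 : ℕ)) ≠ 1 := hprim.ne_one (by norm_num)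
  have hω : fundamentalRep (Fin 3)
      (Literature.Barriers.QuantumFields.scalarCenter 3 _ hωn (by norm_num)) =
      Complex.exp (2 * Real.pi * Complex.I / (3 : ℕ)) • (1 : Matrix (Fin 3) (Fin 3) ℂ) := rfl
  -- the explicit floor is a common lower bound of all plaquette means, and is non-negative
  have hw0 : 0 ≤ 1 - (17 + 3 * Real.log (((d : ℝ) - 1) * β)) / (((d : ℝ) - 1) * β) := by
    rw [sub_nonneg, div_le_one hKpos]
    exact hK'
  have hw : ∀ p : Plaquette d L, 1 - (17 + 3 * Real.log (((d : ℝ) - 1) * β)) / (((d : ℝ) - 1) * β) ≤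
      wilsonExpectation (fundamentalRep (Fin 3)) β
        (fun U : GaugeConfig d L (Matrix.specialUnitaryGroup (Fin 3) ℂ) =>
          ((3 : ℕ) : ℝ)⁻¹ * (fundamentalRep (Fin 3) (plaquetteHolonomy U p.1 p.2.1.1 p.2.1.2)).trace.re) :=
    fun p => Theory2.WeakCoupling.wilsonExpectation_plaquette_ge_su3 hd hK p.1 (ne_of_lt p.2.2)
  have hmain := wilson_tauInt_sign_ge_exp_dim_mul_card_site_div_four_mul_sq (d := d) (L := L)
    (fundamentalRep (Fin 3)) hd (continuous_fundamentalRep (Fin 3)) hL hω hne hw0 hw hqm hcq hqlo hqhi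
    hq1 l hl hall hpw Y hY hqB hgm hg1 hg0
  have hcardSite : Fintype.card (Site d L) = L ^ d := by simp [Site, ZMod.card]
  rw [hcardSite] at hmain
  push_cast at hmain
  exact hmain

end Summit.Ventures.LatticeQCDFlow.Theory2.Autoregressive

end
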